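import Summits.BirchSwinnertonDyer.BirchSwinnertonDyer.Theorems.PrintCFramBottomClassIndexLawFiveLeKrizLi4HeegnerHypothesis11
import Summits.BirchSwinnertonDyer.BirchSwinnertonDyer.Theorems.PrintCFramBottomClassIndexLawFiveLeKrizLi4Blocks11a
import Summits.BirchSwinnertonDyer.BirchSwinnertonDyer.Theorems.PrintCFramBottomClassIndexLawFiveLeKrizLi4Blocks11b
import Summits.BirchSwinnertonDyer.BirchSwinnertonDyer.Theorems.PrintCFramBottomClassIndexLawFiveLeKrizLi4BlocksB11
import Summits.BirchSwinnertonDyer.BirchSwinnertonDyer.Theorems.PrintCFramBottomClassIndexLawFiveLeKrizLi4BlocksC11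
import HarnessLib

/-!
# Crux `PrintCFram.BottomClassIndexLawFiveLe` (stmt-BirchSwinnertonDyer-20372), line `eisenstein-resource-bdp-line` (registered skeleton):
# the composition's KRIZ–LI DATUM `hKLd`, per twisted window class at `p ∈ 11`, modulo the Heegner DATA and the `L`-value —
# `exists_krizLiDatum_<label>`
# (cell `bsd-print-cfram`, width seat `bsd-line-cfram-p1-w5` g0; THEOREMS ONLY, `--supports` 20372; BSD is not proved by any of this)

HONEST FRAMING. Nothing here proves BSD or closes a stub. The registered composition `EisensteinResourceBdpLine.BottomClassIndexLawFiveLe_of`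
splits on `hKLd : ∃ (N K Dt H ι P f ψ ω εK), N_W = N ∧ IsImaginaryQuadratic K ∧ SatisfiesHeegnerHypothesis N K ∧ Odd d_K ∧ d_K < −4 ∧
L(W^{(d_K)},1) ≠ 0 ∧ ι(P) = heegnerPointComplex Dt H ∧ ψ.IsPrimitive ∧ IsTeichmullerCharacter ω ∧ hss ∧ (1) ∧ (3) ∧ IsKroneckerCharacterOf K εK ∧ (4)`.
For each class below this file inhabits that existential VERBATIM from: the per-class character block `KrizLiBindersTwisted.exists_krizLiCharacterBlock_<label>`
(this seat; `3025a` by w3 g3), the per-class Heegner hypothesis `satisfiesHeegnerHypothesis_<label>` (this seat), and — as HYPOTHESES — a quadratic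
`K''` with the census discriminant, Heegner data `(Dt, H, ι, P)` of `W` over `K''` at level `N_W`, and `L(W^{(d_K)}, 1) ≠ 0`. So on every twisted
window class at `p ≥ 11` the composition is in case (KL) BY NAME, given those two analytic inputs (the parametrisation / Heegner point supply of
`ToricPublishedInputs` and one numerical `L`-value), and its conclusion there is whatever the registered on-locus branch proves (prints + Kriz–Li
Thm. 1.20 + the Stub-H descendants of the current registry). Classes: `165649g1` (`37`, `-7`); `193600gy1` (`10`, `-39`); `203401d1` (`41`, `-39`); `339889i1` (`53`, `-7`); `379456fy1` (`14`, `-87`); `393129bw1` (`57`, `-107`); `435600kh1` (`15`, `-239`); `450241d1` (`61`, `-19`).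
beyond-print theorem: NO. References: [KrizLi2019] Thm. 1.20 (pp. 7–8), Rem. 1.21, §2; [GrossLMS1991] §1; [Cox2013] §1.C.
-/

set_option autoImplicit false
set_option linter.dupNamespace false

noncomputable section

open scoped Classical

namespace Summit.BirchSwinnertonDyer.BirchSwinnertonDyer.Theorems.PrintCFram.KrizLiBindersTwisted

open scoped NumberTheorySymbols
open WeierstrassCurve IsDedekindDomain NumberField DirichletCharacter Literature.NumberTheory.LFunctions
  Literature.NumberTheory.EllipticCurves Literature.NumberTheory.EllipticCurves.ModularForms
  Literature.NumberTheory.EllipticCurves.Rank1Residual Literature.NumberTheory.EllipticCurves.KrizLi2019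
  Literature.NumberTheory.QuadraticFields
  Summit.BirchSwinnertonDyer.Rank1Residual Summit.BirchSwinnertonDyer.Rank1Residual.X12.O11

/-- **The composition's Kriz–Li datum for `165649g1` (`A(11)^{(37)}`) over a Heegner field of discriminant `-7`, modulo the Heegner DATA and the
`L`-value**: for every `W ∼ W₁ ≅ A(11)^{(37)}`, every imaginary quadratic `K''` with `d_{K''} = -7`, every modular parametrisation /
Heegner datum / Heegner point `(Dt, H, ι, P)` of `W` over `K''` at level `N_W`, and `L(W^{(-7)}, 1) ≠ 0`, the existential `hKLd` of the
case split of `EisensteinResourceBdpLine.BottomClassIndexLawFiveLe_of` (registered skeleton, `Cruxes/…/Lines/eisenstein_resource_bdp_line.lean`)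
is inhabited VERBATIM — character block `exists_krizLiCharacterBlock_165649g1`, Heegner hypothesis `satisfiesHeegnerHypothesis_165649g1`, `d_K` odd and `< −4` by
evaluation. So `165649g1` is in case (KL) of the composition by name, given the Heegner data and the `L`-value.
[cite: KrizLi2019, Thm. 1.20 (pp. 7–8), Rem. 1.21] [cite: GrossLMS1991, §1 (p. 235)] -/
theorem exists_krizLiDatum_165649g1 [Fact (Nat.Prime 11)] (W W₁ : WeierstrassCurve ℚ) [W.IsElliptic] [W₁.IsElliptic]
    (hiso : IsIsogenous W W₁) (hW₁ : ∃ C : VariableChange ℚ, C • W₁ = cm11.quadraticTwist ((37 : ℤ) : ℚ))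
    (K : Type) [Field K] [NumberField K] (hK : IsImaginaryQuadratic K) (hdK : NumberField.discr K = -7)
    [NeZero (NumberField.discr K).natAbs] [NeZero (W.conductorNorm ℤ)]
    (Dt : ModularParametrizationData W (W.conductorNorm ℤ)) (H : HeegnerDatum (W.conductorNorm ℤ) (NumberField.discr K))
    (ι : K →+* ℂ) (P : (W.baseChange K).toAffine.Point)
    (hP : WeierstrassCurve.Affine.Point.map ι.toRatAlgHom P = heegnerPointComplex Dt H)
    (hLt : (W.quadraticTwist (NumberField.discr K : ℚ)).entireLFunction 1 ≠ 0) :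
    ∃ (N : ℕ) (_ : NeZero N) (K : Type) (_ : Field K) (_ : NumberField K) (Dt : ModularParametrizationData W N)
      (H : HeegnerDatum N (NumberField.discr K)) (ι : K →+* ℂ) (P : (W.baseChange K).toAffine.Point)
      (f : ℕ) (_ : NeZero f) (ψ : DirichletCharacter ℚ_[11] f) (ω : DirichletCharacter ℚ_[11] 11)
      (εK : DirichletCharacter ℚ_[11] (NumberField.discr K).natAbs),
      W.conductorNorm ℤ = N ∧ IsImaginaryQuadratic K ∧ SatisfiesHeegnerHypothesis N K ∧ Odd (NumberField.discr K) ∧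
      NumberField.discr K < -4 ∧ (W.quadraticTwist (NumberField.discr K : ℚ)).entireLFunction 1 ≠ 0 ∧
      WeierstrassCurve.Affine.Point.map ι.toRatAlgHom P = heegnerPointComplex Dt H ∧
      ψ.IsPrimitive ∧ IsTeichmullerCharacter ω ∧
      (∀ ℓ : ℕ, ℓ.Prime → ¬ (ℓ ∣ 11 * W.conductorNorm ℤ) →
        ‖((W.LFunction ℓ : ℤ) : ℚ_[11]) - (ψ (ℓ : ZMod f) + ψ⁻¹ (ℓ : ZMod f) * ω (ℓ : ZMod 11))‖ < 1) ∧
      ψ ((11 : ℕ) : ZMod f) ≠ 1 ∧ primVal (invMulOmega ψ ω) 11 ≠ 1 ∧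
      (∀ ℓ : ℕ, (hℓ : ℓ.Prime) → ℓ ≠ 11 →
        (haveI := Fact.mk hℓ; ¬ W.HasGoodReductionAtPrime ℓ ∧ ¬ W.HasMultiplicativeReductionAtPrime ℓ) →
        ψ (ℓ : ZMod f) ≠ 1 ∧ primVal (invMulOmega ψ ω) ℓ ≠ 1) ∧
      IsKroneckerCharacterOf K εK ∧
      ¬ (‖bernoulliOnePrim (bernoulliCharOne ψ εK) * bernoulliOnePrim (bernoulliCharTwo ψ εK ω)‖ ≤ ((11 : ℕ) : ℝ)⁻¹) := by
  obtain ⟨f, hf, ψ, ω, εK, hψ, hω, hss, ⟨h1, h1'⟩, h3, hεK, h4, -⟩ := exists_krizLiCharacterBlock_165649g1 W W₁ hiso hW₁ K hK.1 hdK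
  have hodd : Odd (NumberField.discr K) := by rw [hdK]; decide
  have hd4 : NumberField.discr K < -4 := by rw [hdK]; norm_num
  exact ⟨W.conductorNorm ℤ, inferInstance, K, inferInstance, inferInstance, Dt, H, ι, P, f, hf, ψ, ω, εK, rfl, hK,
    satisfiesHeegnerHypothesis_165649g1 W W₁ hiso hW₁ K hK.1 hdK, hodd, hd4, hLt, hP, hψ, hω, hss,
    h1, h1', h3, hεK, h4⟩

/-- **The composition's Kriz–Li datum for `193600gy1` (`A(11)^{(10)}`) over a Heegner field of discriminant `-39`, modulo the Heegner DATA and the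
`L`-value**: for every `W ∼ W₁ ≅ A(11)^{(10)}`, every imaginary quadratic `K''` with `d_{K''} = -39`, every modular parametrisation /
Heegner datum / Heegner point `(Dt, H, ι, P)` of `W` over `K''` at level `N_W`, and `L(W^{(-39)}, 1) ≠ 0`, the existential `hKLd` of the
case split of `EisensteinResourceBdpLine.BottomClassIndexLawFiveLe_of` (registered skeleton, `Cruxes/…/Lines/eisenstein_resource_bdp_line.lean`)
is inhabited VERBATIM — character block `exists_krizLiCharacterBlock_193600gy1`, Heegner hypothesis `satisfiesHeegnerHypothesis_193600gy1`, `d_K` odd and `< −4` by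
evaluation. So `193600gy1` is in case (KL) of the composition by name, given the Heegner data and the `L`-value.
[cite: KrizLi2019, Thm. 1.20 (pp. 7–8), Rem. 1.21] [cite: GrossLMS1991, §1 (p. 235)] -/
theorem exists_krizLiDatum_193600gy1 [Fact (Nat.Prime 11)] (W W₁ : WeierstrassCurve ℚ) [W.IsElliptic] [W₁.IsElliptic]
    (hiso : IsIsogenous W W₁) (hW₁ : ∃ C : VariableChange ℚ, C • W₁ = cm11.quadraticTwist ((10 : ℤ) : ℚ))
    (K : Type) [Field K] [NumberField K] (hK : IsImaginaryQuadratic K) (hdK : NumberField.discr K = -39)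
    [NeZero (NumberField.discr K).natAbs] [NeZero (W.conductorNorm ℤ)]
    (Dt : ModularParametrizationData W (W.conductorNorm ℤ)) (H : HeegnerDatum (W.conductorNorm ℤ) (NumberField.discr K))
    (ι : K →+* ℂ) (P : (W.baseChange K).toAffine.Point)
    (hP : WeierstrassCurve.Affine.Point.map ι.toRatAlgHom P = heegnerPointComplex Dt H)
    (hLt : (W.quadraticTwist (NumberField.discr K : ℚ)).entireLFunction 1 ≠ 0) :
    ∃ (N : ℕ) (_ : NeZero N) (K : Type) (_ : Field K) (_ : NumberField K) (Dt : ModularParametrizationData W N)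
      (H : HeegnerDatum N (NumberField.discr K)) (ι : K →+* ℂ) (P : (W.baseChange K).toAffine.Point)
      (f : ℕ) (_ : NeZero f) (ψ : DirichletCharacter ℚ_[11] f) (ω : DirichletCharacter ℚ_[11] 11)
      (εK : DirichletCharacter ℚ_[11] (NumberField.discr K).natAbs),
      W.conductorNorm ℤ = N ∧ IsImaginaryQuadratic K ∧ SatisfiesHeegnerHypothesis N K ∧ Odd (NumberField.discr K) ∧
      NumberField.discr K < -4 ∧ (W.quadraticTwist (NumberField.discr K : ℚ)).entireLFunction 1 ≠ 0 ∧
      WeierstrassCurve.Affine.Point.map ι.toRatAlgHom P = heegnerPointComplex Dt H ∧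
      ψ.IsPrimitive ∧ IsTeichmullerCharacter ω ∧
      (∀ ℓ : ℕ, ℓ.Prime → ¬ (ℓ ∣ 11 * W.conductorNorm ℤ) →
        ‖((W.LFunction ℓ : ℤ) : ℚ_[11]) - (ψ (ℓ : ZMod f) + ψ⁻¹ (ℓ : ZMod f) * ω (ℓ : ZMod 11))‖ < 1) ∧
      ψ ((11 : ℕ) : ZMod f) ≠ 1 ∧ primVal (invMulOmega ψ ω) 11 ≠ 1 ∧
      (∀ ℓ : ℕ, (hℓ : ℓ.Prime) → ℓ ≠ 11 →
        (haveI := Fact.mk hℓ; ¬ W.HasGoodReductionAtPrime ℓ ∧ ¬ W.HasMultiplicativeReductionAtPrime ℓ) →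
        ψ (ℓ : ZMod f) ≠ 1 ∧ primVal (invMulOmega ψ ω) ℓ ≠ 1) ∧
      IsKroneckerCharacterOf K εK ∧
      ¬ (‖bernoulliOnePrim (bernoulliCharOne ψ εK) * bernoulliOnePrim (bernoulliCharTwo ψ εK ω)‖ ≤ ((11 : ℕ) : ℝ)⁻¹) := by
  obtain ⟨f, hf, ψ, ω, εK, hψ, hω, hss, ⟨h1, h1'⟩, h3, hεK, h4, -⟩ := exists_krizLiCharacterBlock_193600gy1 W W₁ hiso hW₁ K hK.1 hdK
  have hodd : Odd (NumberField.discr K) := by rw [hdK]; decide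
  have hd4 : NumberField.discr K < -4 := by rw [hdK]; norm_num
  exact ⟨W.conductorNorm ℤ, inferInstance, K, inferInstance, inferInstance, Dt, H, ι, P, f, hf, ψ, ω, εK, rfl, hK,
    satisfiesHeegnerHypothesis_193600gy1 W W₁ hiso hW₁ K hK.1 hdK, hodd, hd4, hLt, hP, hψ, hω, hss,
    h1, h1', h3, hεK, h4⟩

/-- **The composition's Kriz–Li datum for `203401d1` (`A(11)^{(41)}`) over a Heegner field of discriminant `-39`, modulo the Heegner DATA and the
`L`-value**: for every `W ∼ W₁ ≅ A(11)^{(41)}`, every imaginary quadratic `K''` with `d_{K''} = -39`, every modular parametrisation /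
Heegner datum / Heegner point `(Dt, H, ι, P)` of `W` over `K''` at level `N_W`, and `L(W^{(-39)}, 1) ≠ 0`, the existential `hKLd` of the
case split of `EisensteinResourceBdpLine.BottomClassIndexLawFiveLe_of` (registered skeleton, `Cruxes/…/Lines/eisenstein_resource_bdp_line.lean`)
is inhabited VERBATIM — character block `exists_krizLiCharacterBlock_203401d1`, Heegner hypothesis `satisfiesHeegnerHypothesis_203401d1`, `d_K` odd and `< −4` by
evaluation. So `203401d1` is in case (KL) of the composition by name, given the Heegner data and the `L`-value.
[cite: KrizLi2019, Thm. 1.20 (pp. 7–8), Rem. 1.21] [cite: GrossLMS1991, §1 (p. 235)] -/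
theorem exists_krizLiDatum_203401d1 [Fact (Nat.Prime 11)] (W W₁ : WeierstrassCurve ℚ) [W.IsElliptic] [W₁.IsElliptic]
    (hiso : IsIsogenous W W₁) (hW₁ : ∃ C : VariableChange ℚ, C • W₁ = cm11.quadraticTwist ((41 : ℤ) : ℚ))
    (K : Type) [Field K] [NumberField K] (hK : IsImaginaryQuadratic K) (hdK : NumberField.discr K = -39)
    [NeZero (NumberField.discr K).natAbs] [NeZero (W.conductorNorm ℤ)]
    (Dt : ModularParametrizationData W (W.conductorNorm ℤ)) (H : HeegnerDatum (W.conductorNorm ℤ) (NumberField.discr K))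
    (ι : K →+* ℂ) (P : (W.baseChange K).toAffine.Point)
    (hP : WeierstrassCurve.Affine.Point.map ι.toRatAlgHom P = heegnerPointComplex Dt H)
    (hLt : (W.quadraticTwist (NumberField.discr K : ℚ)).entireLFunction 1 ≠ 0) :
    ∃ (N : ℕ) (_ : NeZero N) (K : Type) (_ : Field K) (_ : NumberField K) (Dt : ModularParametrizationData W N)
      (H : HeegnerDatum N (NumberField.discr K)) (ι : K →+* ℂ) (P : (W.baseChange K).toAffine.Point)
      (f : ℕ) (_ : NeZero f) (ψ : DirichletCharacter ℚ_[11] f) (ω : DirichletCharacter ℚ_[11] 11)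
      (εK : DirichletCharacter ℚ_[11] (NumberField.discr K).natAbs),
      W.conductorNorm ℤ = N ∧ IsImaginaryQuadratic K ∧ SatisfiesHeegnerHypothesis N K ∧ Odd (NumberField.discr K) ∧
      NumberField.discr K < -4 ∧ (W.quadraticTwist (NumberField.discr K : ℚ)).entireLFunction 1 ≠ 0 ∧
      WeierstrassCurve.Affine.Point.map ι.toRatAlgHom P = heegnerPointComplex Dt H ∧
      ψ.IsPrimitive ∧ IsTeichmullerCharacter ω ∧
      (∀ ℓ : ℕ, ℓ.Prime → ¬ (ℓ ∣ 11 * W.conductorNorm ℤ) →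
        ‖((W.LFunction ℓ : ℤ) : ℚ_[11]) - (ψ (ℓ : ZMod f) + ψ⁻¹ (ℓ : ZMod f) * ω (ℓ : ZMod 11))‖ < 1) ∧
      ψ ((11 : ℕ) : ZMod f) ≠ 1 ∧ primVal (invMulOmega ψ ω) 11 ≠ 1 ∧
      (∀ ℓ : ℕ, (hℓ : ℓ.Prime) → ℓ ≠ 11 →
        (haveI := Fact.mk hℓ; ¬ W.HasGoodReductionAtPrime ℓ ∧ ¬ W.HasMultiplicativeReductionAtPrime ℓ) →
        ψ (ℓ : ZMod f) ≠ 1 ∧ primVal (invMulOmega ψ ω) ℓ ≠ 1) ∧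
      IsKroneckerCharacterOf K εK ∧
      ¬ (‖bernoulliOnePrim (bernoulliCharOne ψ εK) * bernoulliOnePrim (bernoulliCharTwo ψ εK ω)‖ ≤ ((11 : ℕ) : ℝ)⁻¹) := by
  obtain ⟨f, hf, ψ, ω, εK, hψ, hω, hss, ⟨h1, h1'⟩, h3, hεK, h4, -⟩ := exists_krizLiCharacterBlock_203401d1 W W₁ hiso hW₁ K hK.1 hdK
  have hodd : Odd (NumberField.discr K) := by rw [hdK]; decide
  have hd4 : NumberField.discr K < -4 := by rw [hdK]; norm_num
  exact ⟨W.conductorNorm ℤ, inferInstance, K, inferInstance, inferInstance, Dt, H, ι, P, f, hf, ψ, ω, εK, rfl, hK,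
    satisfiesHeegnerHypothesis_203401d1 W W₁ hiso hW₁ K hK.1 hdK, hodd, hd4, hLt, hP, hψ, hω, hss,
    h1, h1', h3, hεK, h4⟩

/-- **The composition's Kriz–Li datum for `339889i1` (`A(11)^{(53)}`) over a Heegner field of discriminant `-7`, modulo the Heegner DATA and the
`L`-value**: for every `W ∼ W₁ ≅ A(11)^{(53)}`, every imaginary quadratic `K''` with `d_{K''} = -7`, every modular parametrisation /
Heegner datum / Heegner point `(Dt, H, ι, P)` of `W` over `K''` at level `N_W`, and `L(W^{(-7)}, 1) ≠ 0`, the existential `hKLd` of the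
case split of `EisensteinResourceBdpLine.BottomClassIndexLawFiveLe_of` (registered skeleton, `Cruxes/…/Lines/eisenstein_resource_bdp_line.lean`)
is inhabited VERBATIM — character block `exists_krizLiCharacterBlock_339889i1`, Heegner hypothesis `satisfiesHeegnerHypothesis_339889i1`, `d_K` odd and `< −4` by
evaluation. So `339889i1` is in case (KL) of the composition by name, given the Heegner data and the `L`-value.
[cite: KrizLi2019, Thm. 1.20 (pp. 7–8), Rem. 1.21] [cite: GrossLMS1991, §1 (p. 235)] -/
theorem exists_krizLiDatum_339889i1 [Fact (Nat.Prime 11)] (W W₁ : WeierstrassCurve ℚ) [W.IsElliptic] [W₁.IsElliptic]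
    (hiso : IsIsogenous W W₁) (hW₁ : ∃ C : VariableChange ℚ, C • W₁ = cm11.quadraticTwist ((53 : ℤ) : ℚ))
    (K : Type) [Field K] [NumberField K] (hK : IsImaginaryQuadratic K) (hdK : NumberField.discr K = -7)
    [NeZero (NumberField.discr K).natAbs] [NeZero (W.conductorNorm ℤ)]
    (Dt : ModularParametrizationData W (W.conductorNorm ℤ)) (H : HeegnerDatum (W.conductorNorm ℤ) (NumberField.discr K))
    (ι : K →+* ℂ) (P : (W.baseChange K).toAffine.Point)
    (hP : WeierstrassCurve.Affine.Point.map ι.toRatAlgHom P = heegnerPointComplex Dt H)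
    (hLt : (W.quadraticTwist (NumberField.discr K : ℚ)).entireLFunction 1 ≠ 0) :
    ∃ (N : ℕ) (_ : NeZero N) (K : Type) (_ : Field K) (_ : NumberField K) (Dt : ModularParametrizationData W N)
      (H : HeegnerDatum N (NumberField.discr K)) (ι : K →+* ℂ) (P : (W.baseChange K).toAffine.Point)
      (f : ℕ) (_ : NeZero f) (ψ : DirichletCharacter ℚ_[11] f) (ω : DirichletCharacter ℚ_[11] 11)
      (εK : DirichletCharacter ℚ_[11] (NumberField.discr K).natAbs),
      W.conductorNorm ℤ = N ∧ IsImaginaryQuadratic K ∧ SatisfiesHeegnerHypothesis N K ∧ Odd (NumberField.discr K) ∧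
      NumberField.discr K < -4 ∧ (W.quadraticTwist (NumberField.discr K : ℚ)).entireLFunction 1 ≠ 0 ∧
      WeierstrassCurve.Affine.Point.map ι.toRatAlgHom P = heegnerPointComplex Dt H ∧
      ψ.IsPrimitive ∧ IsTeichmullerCharacter ω ∧
      (∀ ℓ : ℕ, ℓ.Prime → ¬ (ℓ ∣ 11 * W.conductorNorm ℤ) →
        ‖((W.LFunction ℓ : ℤ) : ℚ_[11]) - (ψ (ℓ : ZMod f) + ψ⁻¹ (ℓ : ZMod f) * ω (ℓ : ZMod 11))‖ < 1) ∧
      ψ ((11 : ℕ) : ZMod f) ≠ 1 ∧ primVal (invMulOmega ψ ω) 11 ≠ 1 ∧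
      (∀ ℓ : ℕ, (hℓ : ℓ.Prime) → ℓ ≠ 11 →
        (haveI := Fact.mk hℓ; ¬ W.HasGoodReductionAtPrime ℓ ∧ ¬ W.HasMultiplicativeReductionAtPrime ℓ) →
        ψ (ℓ : ZMod f) ≠ 1 ∧ primVal (invMulOmega ψ ω) ℓ ≠ 1) ∧
      IsKroneckerCharacterOf K εK ∧
      ¬ (‖bernoulliOnePrim (bernoulliCharOne ψ εK) * bernoulliOnePrim (bernoulliCharTwo ψ εK ω)‖ ≤ ((11 : ℕ) : ℝ)⁻¹) := by
  obtain ⟨f, hf, ψ, ω, εK, hψ, hω, hss, ⟨h1, h1'⟩, h3, hεK, h4, -⟩ := exists_krizLiCharacterBlock_339889i1 W W₁ hiso hW₁ K hK.1 hdK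
  have hodd : Odd (NumberField.discr K) := by rw [hdK]; decide
  have hd4 : NumberField.discr K < -4 := by rw [hdK]; norm_num
  exact ⟨W.conductorNorm ℤ, inferInstance, K, inferInstance, inferInstance, Dt, H, ι, P, f, hf, ψ, ω, εK, rfl, hK,
    satisfiesHeegnerHypothesis_339889i1 W W₁ hiso hW₁ K hK.1 hdK, hodd, hd4, hLt, hP, hψ, hω, hss,
    h1, h1', h3, hεK, h4⟩

/-- **The composition's Kriz–Li datum for `379456fy1` (`A(11)^{(14)}`) over a Heegner field of discriminant `-87`, modulo the Heegner DATA and the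
`L`-value**: for every `W ∼ W₁ ≅ A(11)^{(14)}`, every imaginary quadratic `K''` with `d_{K''} = -87`, every modular parametrisation /
Heegner datum / Heegner point `(Dt, H, ι, P)` of `W` over `K''` at level `N_W`, and `L(W^{(-87)}, 1) ≠ 0`, the existential `hKLd` of the
case split of `EisensteinResourceBdpLine.BottomClassIndexLawFiveLe_of` (registered skeleton, `Cruxes/…/Lines/eisenstein_resource_bdp_line.lean`)
is inhabited VERBATIM — character block `exists_krizLiCharacterBlock_379456fy1`, Heegner hypothesis `satisfiesHeegnerHypothesis_379456fy1`, `d_K` odd and `< −4` by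
evaluation. So `379456fy1` is in case (KL) of the composition by name, given the Heegner data and the `L`-value.
[cite: KrizLi2019, Thm. 1.20 (pp. 7–8), Rem. 1.21] [cite: GrossLMS1991, §1 (p. 235)] -/
theorem exists_krizLiDatum_379456fy1 [Fact (Nat.Prime 11)] (W W₁ : WeierstrassCurve ℚ) [W.IsElliptic] [W₁.IsElliptic]
    (hiso : IsIsogenous W W₁) (hW₁ : ∃ C : VariableChange ℚ, C • W₁ = cm11.quadraticTwist ((14 : ℤ) : ℚ))
    (K : Type) [Field K] [NumberField K] (hK : IsImaginaryQuadratic K) (hdK : NumberField.discr K = -87)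
    [NeZero (NumberField.discr K).natAbs] [NeZero (W.conductorNorm ℤ)]
    (Dt : ModularParametrizationData W (W.conductorNorm ℤ)) (H : HeegnerDatum (W.conductorNorm ℤ) (NumberField.discr K))
    (ι : K →+* ℂ) (P : (W.baseChange K).toAffine.Point)
    (hP : WeierstrassCurve.Affine.Point.map ι.toRatAlgHom P = heegnerPointComplex Dt H)
    (hLt : (W.quadraticTwist (NumberField.discr K : ℚ)).entireLFunction 1 ≠ 0) :
    ∃ (N : ℕ) (_ : NeZero N) (K : Type) (_ : Field K) (_ : NumberField K) (Dt : ModularParametrizationData W N)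
      (H : HeegnerDatum N (NumberField.discr K)) (ι : K →+* ℂ) (P : (W.baseChange K).toAffine.Point)
      (f : ℕ) (_ : NeZero f) (ψ : DirichletCharacter ℚ_[11] f) (ω : DirichletCharacter ℚ_[11] 11)
      (εK : DirichletCharacter ℚ_[11] (NumberField.discr K).natAbs),
      W.conductorNorm ℤ = N ∧ IsImaginaryQuadratic K ∧ SatisfiesHeegnerHypothesis N K ∧ Odd (NumberField.discr K) ∧
      NumberField.discr K < -4 ∧ (W.quadraticTwist (NumberField.discr K : ℚ)).entireLFunction 1 ≠ 0 ∧
      WeierstrassCurve.Affine.Point.map ι.toRatAlgHom P = heegnerPointComplex Dt H ∧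
      ψ.IsPrimitive ∧ IsTeichmullerCharacter ω ∧
      (∀ ℓ : ℕ, ℓ.Prime → ¬ (ℓ ∣ 11 * W.conductorNorm ℤ) →
        ‖((W.LFunction ℓ : ℤ) : ℚ_[11]) - (ψ (ℓ : ZMod f) + ψ⁻¹ (ℓ : ZMod f) * ω (ℓ : ZMod 11))‖ < 1) ∧
      ψ ((11 : ℕ) : ZMod f) ≠ 1 ∧ primVal (invMulOmega ψ ω) 11 ≠ 1 ∧
      (∀ ℓ : ℕ, (hℓ : ℓ.Prime) → ℓ ≠ 11 →
        (haveI := Fact.mk hℓ; ¬ W.HasGoodReductionAtPrime ℓ ∧ ¬ W.HasMultiplicativeReductionAtPrime ℓ) →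
        ψ (ℓ : ZMod f) ≠ 1 ∧ primVal (invMulOmega ψ ω) ℓ ≠ 1) ∧
      IsKroneckerCharacterOf K εK ∧
      ¬ (‖bernoulliOnePrim (bernoulliCharOne ψ εK) * bernoulliOnePrim (bernoulliCharTwo ψ εK ω)‖ ≤ ((11 : ℕ) : ℝ)⁻¹) := by
  obtain ⟨f, hf, ψ, ω, εK, hψ, hω, hss, ⟨h1, h1'⟩, h3, hεK, h4, -⟩ := exists_krizLiCharacterBlock_379456fy1 W W₁ hiso hW₁ K hK.1 hdK
  have hodd : Odd (NumberField.discr K) := by rw [hdK]; decide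
  have hd4 : NumberField.discr K < -4 := by rw [hdK]; norm_num
  exact ⟨W.conductorNorm ℤ, inferInstance, K, inferInstance, inferInstance, Dt, H, ι, P, f, hf, ψ, ω, εK, rfl, hK,
    satisfiesHeegnerHypothesis_379456fy1 W W₁ hiso hW₁ K hK.1 hdK, hodd, hd4, hLt, hP, hψ, hω, hss,
    h1, h1', h3, hεK, h4⟩

/-- **The composition's Kriz–Li datum for `393129bw1` (`A(11)^{(57)}`) over a Heegner field of discriminant `-107`, modulo the Heegner DATA and the
`L`-value**: for every `W ∼ W₁ ≅ A(11)^{(57)}`, every imaginary quadratic `K''` with `d_{K''} = -107`, every modular parametrisation /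
Heegner datum / Heegner point `(Dt, H, ι, P)` of `W` over `K''` at level `N_W`, and `L(W^{(-107)}, 1) ≠ 0`, the existential `hKLd` of the
case split of `EisensteinResourceBdpLine.BottomClassIndexLawFiveLe_of` (registered skeleton, `Cruxes/…/Lines/eisenstein_resource_bdp_line.lean`)
is inhabited VERBATIM — character block `exists_krizLiCharacterBlock_393129bw1`, Heegner hypothesis `satisfiesHeegnerHypothesis_393129bw1`, `d_K` odd and `< −4` by
evaluation. So `393129bw1` is in case (KL) of the composition by name, given the Heegner data and the `L`-value.
[cite: KrizLi2019, Thm. 1.20 (pp. 7–8), Rem. 1.21] [cite: GrossLMS1991, §1 (p. 235)] -/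
theorem exists_krizLiDatum_393129bw1 [Fact (Nat.Prime 11)] (W W₁ : WeierstrassCurve ℚ) [W.IsElliptic] [W₁.IsElliptic]
    (hiso : IsIsogenous W W₁) (hW₁ : ∃ C : VariableChange ℚ, C • W₁ = cm11.quadraticTwist ((57 : ℤ) : ℚ))
    (K : Type) [Field K] [NumberField K] (hK : IsImaginaryQuadratic K) (hdK : NumberField.discr K = -107)
    [NeZero (NumberField.discr K).natAbs] [NeZero (W.conductorNorm ℤ)]
    (Dt : ModularParametrizationData W (W.conductorNorm ℤ)) (H : HeegnerDatum (W.conductorNorm ℤ) (NumberField.discr K))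
    (ι : K →+* ℂ) (P : (W.baseChange K).toAffine.Point)
    (hP : WeierstrassCurve.Affine.Point.map ι.toRatAlgHom P = heegnerPointComplex Dt H)
    (hLt : (W.quadraticTwist (NumberField.discr K : ℚ)).entireLFunction 1 ≠ 0) :
    ∃ (N : ℕ) (_ : NeZero N) (K : Type) (_ : Field K) (_ : NumberField K) (Dt : ModularParametrizationData W N)
      (H : HeegnerDatum N (NumberField.discr K)) (ι : K →+* ℂ) (P : (W.baseChange K).toAffine.Point)
      (f : ℕ) (_ : NeZero f) (ψ : DirichletCharacter ℚ_[11] f) (ω : DirichletCharacter ℚ_[11] 11)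
      (εK : DirichletCharacter ℚ_[11] (NumberField.discr K).natAbs),
      W.conductorNorm ℤ = N ∧ IsImaginaryQuadratic K ∧ SatisfiesHeegnerHypothesis N K ∧ Odd (NumberField.discr K) ∧
      NumberField.discr K < -4 ∧ (W.quadraticTwist (NumberField.discr K : ℚ)).entireLFunction 1 ≠ 0 ∧
      WeierstrassCurve.Affine.Point.map ι.toRatAlgHom P = heegnerPointComplex Dt H ∧
      ψ.IsPrimitive ∧ IsTeichmullerCharacter ω ∧
      (∀ ℓ : ℕ, ℓ.Prime → ¬ (ℓ ∣ 11 * W.conductorNorm ℤ) →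
        ‖((W.LFunction ℓ : ℤ) : ℚ_[11]) - (ψ (ℓ : ZMod f) + ψ⁻¹ (ℓ : ZMod f) * ω (ℓ : ZMod 11))‖ < 1) ∧
      ψ ((11 : ℕ) : ZMod f) ≠ 1 ∧ primVal (invMulOmega ψ ω) 11 ≠ 1 ∧
      (∀ ℓ : ℕ, (hℓ : ℓ.Prime) → ℓ ≠ 11 →
        (haveI := Fact.mk hℓ; ¬ W.HasGoodReductionAtPrime ℓ ∧ ¬ W.HasMultiplicativeReductionAtPrime ℓ) →
        ψ (ℓ : ZMod f) ≠ 1 ∧ primVal (invMulOmega ψ ω) ℓ ≠ 1) ∧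
      IsKroneckerCharacterOf K εK ∧
      ¬ (‖bernoulliOnePrim (bernoulliCharOne ψ εK) * bernoulliOnePrim (bernoulliCharTwo ψ εK ω)‖ ≤ ((11 : ℕ) : ℝ)⁻¹) := by
  obtain ⟨f, hf, ψ, ω, εK, hψ, hω, hss, ⟨h1, h1'⟩, h3, hεK, h4, -⟩ := exists_krizLiCharacterBlock_393129bw1 W W₁ hiso hW₁ K hK.1 hdK
  have hodd : Odd (NumberField.discr K) := by rw [hdK]; decide
  have hd4 : NumberField.discr K < -4 := by rw [hdK]; norm_num
  exact ⟨W.conductorNorm ℤ, inferInstance, K, inferInstance, inferInstance, Dt, H, ι, P, f, hf, ψ, ω, εK, rfl, hK,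
    satisfiesHeegnerHypothesis_393129bw1 W W₁ hiso hW₁ K hK.1 hdK, hodd, hd4, hLt, hP, hψ, hω, hss,
    h1, h1', h3, hεK, h4⟩

/-- **The composition's Kriz–Li datum for `435600kh1` (`A(11)^{(15)}`) over a Heegner field of discriminant `-239`, modulo the Heegner DATA and the
`L`-value**: for every `W ∼ W₁ ≅ A(11)^{(15)}`, every imaginary quadratic `K''` with `d_{K''} = -239`, every modular parametrisation /
Heegner datum / Heegner point `(Dt, H, ι, P)` of `W` over `K''` at level `N_W`, and `L(W^{(-239)}, 1) ≠ 0`, the existential `hKLd` of the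
case split of `EisensteinResourceBdpLine.BottomClassIndexLawFiveLe_of` (registered skeleton, `Cruxes/…/Lines/eisenstein_resource_bdp_line.lean`)
is inhabited VERBATIM — character block `exists_krizLiCharacterBlock_435600kh1`, Heegner hypothesis `satisfiesHeegnerHypothesis_435600kh1`, `d_K` odd and `< −4` by
evaluation. So `435600kh1` is in case (KL) of the composition by name, given the Heegner data and the `L`-value.
[cite: KrizLi2019, Thm. 1.20 (pp. 7–8), Rem. 1.21] [cite: GrossLMS1991, §1 (p. 235)] -/
theorem exists_krizLiDatum_435600kh1 [Fact (Nat.Prime 11)] (W W₁ : WeierstrassCurve ℚ) [W.IsElliptic] [W₁.IsElliptic]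
    (hiso : IsIsogenous W W₁) (hW₁ : ∃ C : VariableChange ℚ, C • W₁ = cm11.quadraticTwist ((15 : ℤ) : ℚ))
    (K : Type) [Field K] [NumberField K] (hK : IsImaginaryQuadratic K) (hdK : NumberField.discr K = -239)
    [NeZero (NumberField.discr K).natAbs] [NeZero (W.conductorNorm ℤ)]
    (Dt : ModularParametrizationData W (W.conductorNorm ℤ)) (H : HeegnerDatum (W.conductorNorm ℤ) (NumberField.discr K))
    (ι : K →+* ℂ) (P : (W.baseChange K).toAffine.Point)
    (hP : WeierstrassCurve.Affine.Point.map ι.toRatAlgHom P = heegnerPointComplex Dt H)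
    (hLt : (W.quadraticTwist (NumberField.discr K : ℚ)).entireLFunction 1 ≠ 0) :
    ∃ (N : ℕ) (_ : NeZero N) (K : Type) (_ : Field K) (_ : NumberField K) (Dt : ModularParametrizationData W N)
      (H : HeegnerDatum N (NumberField.discr K)) (ι : K →+* ℂ) (P : (W.baseChange K).toAffine.Point)
      (f : ℕ) (_ : NeZero f) (ψ : DirichletCharacter ℚ_[11] f) (ω : DirichletCharacter ℚ_[11] 11)
      (εK : DirichletCharacter ℚ_[11] (NumberField.discr K).natAbs),
      W.conductorNorm ℤ = N ∧ IsImaginaryQuadratic K ∧ SatisfiesHeegnerHypothesis N K ∧ Odd (NumberField.discr K) ∧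
      NumberField.discr K < -4 ∧ (W.quadraticTwist (NumberField.discr K : ℚ)).entireLFunction 1 ≠ 0 ∧
      WeierstrassCurve.Affine.Point.map ι.toRatAlgHom P = heegnerPointComplex Dt H ∧
      ψ.IsPrimitive ∧ IsTeichmullerCharacter ω ∧
      (∀ ℓ : ℕ, ℓ.Prime → ¬ (ℓ ∣ 11 * W.conductorNorm ℤ) →
        ‖((W.LFunction ℓ : ℤ) : ℚ_[11]) - (ψ (ℓ : ZMod f) + ψ⁻¹ (ℓ : ZMod f) * ω (ℓ : ZMod 11))‖ < 1) ∧
      ψ ((11 : ℕ) : ZMod f) ≠ 1 ∧ primVal (invMulOmega ψ ω) 11 ≠ 1 ∧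
      (∀ ℓ : ℕ, (hℓ : ℓ.Prime) → ℓ ≠ 11 →
        (haveI := Fact.mk hℓ; ¬ W.HasGoodReductionAtPrime ℓ ∧ ¬ W.HasMultiplicativeReductionAtPrime ℓ) →
        ψ (ℓ : ZMod f) ≠ 1 ∧ primVal (invMulOmega ψ ω) ℓ ≠ 1) ∧
      IsKroneckerCharacterOf K εK ∧
      ¬ (‖bernoulliOnePrim (bernoulliCharOne ψ εK) * bernoulliOnePrim (bernoulliCharTwo ψ εK ω)‖ ≤ ((11 : ℕ) : ℝ)⁻¹) := by
  obtain ⟨f, hf, ψ, ω, εK, hψ, hω, hss, ⟨h1, h1'⟩, h3, hεK, h4, -⟩ := exists_krizLiCharacterBlock_435600kh1 W W₁ hiso hW₁ K hK.1 hdK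
  have hodd : Odd (NumberField.discr K) := by rw [hdK]; decide
  have hd4 : NumberField.discr K < -4 := by rw [hdK]; norm_num
  exact ⟨W.conductorNorm ℤ, inferInstance, K, inferInstance, inferInstance, Dt, H, ι, P, f, hf, ψ, ω, εK, rfl, hK,
    satisfiesHeegnerHypothesis_435600kh1 W W₁ hiso hW₁ K hK.1 hdK, hodd, hd4, hLt, hP, hψ, hω, hss,
    h1, h1', h3, hεK, h4⟩

/-- **The composition's Kriz–Li datum for `450241d1` (`A(11)^{(61)}`) over a Heegner field of discriminant `-19`, modulo the Heegner DATA and the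
`L`-value**: for every `W ∼ W₁ ≅ A(11)^{(61)}`, every imaginary quadratic `K''` with `d_{K''} = -19`, every modular parametrisation /
Heegner datum / Heegner point `(Dt, H, ι, P)` of `W` over `K''` at level `N_W`, and `L(W^{(-19)}, 1) ≠ 0`, the existential `hKLd` of the
case split of `EisensteinResourceBdpLine.BottomClassIndexLawFiveLe_of` (registered skeleton, `Cruxes/…/Lines/eisenstein_resource_bdp_line.lean`)
is inhabited VERBATIM — character block `exists_krizLiCharacterBlock_450241d1`, Heegner hypothesis `satisfiesHeegnerHypothesis_450241d1`, `d_K` odd and `< −4` by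
evaluation. So `450241d1` is in case (KL) of the composition by name, given the Heegner data and the `L`-value.
[cite: KrizLi2019, Thm. 1.20 (pp. 7–8), Rem. 1.21] [cite: GrossLMS1991, §1 (p. 235)] -/
theorem exists_krizLiDatum_450241d1 [Fact (Nat.Prime 11)] (W W₁ : WeierstrassCurve ℚ) [W.IsElliptic] [W₁.IsElliptic]
    (hiso : IsIsogenous W W₁) (hW₁ : ∃ C : VariableChange ℚ, C • W₁ = cm11.quadraticTwist ((61 : ℤ) : ℚ))
    (K : Type) [Field K] [NumberField K] (hK : IsImaginaryQuadratic K) (hdK : NumberField.discr K = -19)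
    [NeZero (NumberField.discr K).natAbs] [NeZero (W.conductorNorm ℤ)]
    (Dt : ModularParametrizationData W (W.conductorNorm ℤ)) (H : HeegnerDatum (W.conductorNorm ℤ) (NumberField.discr K))
    (ι : K →+* ℂ) (P : (W.baseChange K).toAffine.Point)
    (hP : WeierstrassCurve.Affine.Point.map ι.toRatAlgHom P = heegnerPointComplex Dt H)
    (hLt : (W.quadraticTwist (NumberField.discr K : ℚ)).entireLFunction 1 ≠ 0) :
    ∃ (N : ℕ) (_ : NeZero N) (K : Type) (_ : Field K) (_ : NumberField K) (Dt : ModularParametrizationData W N)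
      (H : HeegnerDatum N (NumberField.discr K)) (ι : K →+* ℂ) (P : (W.baseChange K).toAffine.Point)
      (f : ℕ) (_ : NeZero f) (ψ : DirichletCharacter ℚ_[11] f) (ω : DirichletCharacter ℚ_[11] 11)
      (εK : DirichletCharacter ℚ_[11] (NumberField.discr K).natAbs),
      W.conductorNorm ℤ = N ∧ IsImaginaryQuadratic K ∧ SatisfiesHeegnerHypothesis N K ∧ Odd (NumberField.discr K) ∧
      NumberField.discr K < -4 ∧ (W.quadraticTwist (NumberField.discr K : ℚ)).entireLFunction 1 ≠ 0 ∧
      WeierstrassCurve.Affine.Point.map ι.toRatAlgHom P = heegnerPointComplex Dt H ∧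
      ψ.IsPrimitive ∧ IsTeichmullerCharacter ω ∧
      (∀ ℓ : ℕ, ℓ.Prime → ¬ (ℓ ∣ 11 * W.conductorNorm ℤ) →
        ‖((W.LFunction ℓ : ℤ) : ℚ_[11]) - (ψ (ℓ : ZMod f) + ψ⁻¹ (ℓ : ZMod f) * ω (ℓ : ZMod 11))‖ < 1) ∧
      ψ ((11 : ℕ) : ZMod f) ≠ 1 ∧ primVal (invMulOmega ψ ω) 11 ≠ 1 ∧
      (∀ ℓ : ℕ, (hℓ : ℓ.Prime) → ℓ ≠ 11 →
        (haveI := Fact.mk hℓ; ¬ W.HasGoodReductionAtPrime ℓ ∧ ¬ W.HasMultiplicativeReductionAtPrime ℓ) →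
        ψ (ℓ : ZMod f) ≠ 1 ∧ primVal (invMulOmega ψ ω) ℓ ≠ 1) ∧
      IsKroneckerCharacterOf K εK ∧
      ¬ (‖bernoulliOnePrim (bernoulliCharOne ψ εK) * bernoulliOnePrim (bernoulliCharTwo ψ εK ω)‖ ≤ ((11 : ℕ) : ℝ)⁻¹) := by
  obtain ⟨f, hf, ψ, ω, εK, hψ, hω, hss, ⟨h1, h1'⟩, h3, hεK, h4, -⟩ := exists_krizLiCharacterBlock_450241d1 W W₁ hiso hW₁ K hK.1 hdK
  have hodd : Odd (NumberField.discr K) := by rw [hdK]; decide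
  have hd4 : NumberField.discr K < -4 := by rw [hdK]; norm_num
  exact ⟨W.conductorNorm ℤ, inferInstance, K, inferInstance, inferInstance, Dt, H, ι, P, f, hf, ψ, ω, εK, rfl, hK,
    satisfiesHeegnerHypothesis_450241d1 W W₁ hiso hW₁ K hK.1 hdK, hodd, hd4, hLt, hP, hψ, hω, hss,
    h1, h1', h3, hεK, h4⟩

end Summit.BirchSwinnertonDyer.BirchSwinnertonDyer.Theorems.PrintCFram.KrizLiBindersTwisted

end
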